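import Mathlib.GroupTheory.Index
import Mathlib.Tactic
import HarnessLib

/-!
# Cell «bsd-uniform», track U2, route C — T4-PROOF Lemma L1 (no `2`-torsion up the ring-class
# tower), GROUP-THEORETIC HALF: generalized dihedral groups have no `C₃` quotient, and an `S₃`
# quotient sees the abelian half exactly as the preimage of `A₃` (sorry-free, pure group theory)

HONEST FRAMING (cell «bsd-uniform», run/shared/lean/pub/bsd-uniform/, seat u2-p3): PURE GROUP THEORY;
no field, no curve, no claim about the Birch–Swinnerton-Dyer conjecture. It is the group half of
T4-PROOF.md v1.9b §3 L1 ("Under (H-2) `E(ℚ)[2] = 0` and (H-Δ) `K ≠ ℚ(√Δ_E)`: `E(H_c)[2] = 0` for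
every ring class field `H_c` of `K`"), whose printed-nowhere proof is: `Γ = Gal(H_c/ℚ) = A ⋊ ⟨ρ⟩`
with `A = Gal(H_c/K)` abelian and complex conjugation `ρ` acting on `A` by inversion; a `2`-torsion
point over `H_c` makes the `2`-division field `F ⊆ H_c`, so `Γ ↠ Gal(F/ℚ) ∈ {C₃, S₃}`; a `C₃`
quotient is impossible (this file, `map_eq_one_of_inv_conj`), and an `S₃` quotient forces
`A = π⁻¹(A₃)` (this file, `eq_comap_of_index_two`), i.e. `K = F^{A₃} = ℚ(√Δ_E)` — excluded. The
FIELD half (a `2`-torsion point of `E(H_c)` gives `F ⊆ H_c`; `F^{A₃} = ℚ(√disc)`; Galois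
correspondence) is NOT here: until it lands, the consumer files carry L1's conclusion as the binder
`h2L : ∀ Q ∈ E(H_M), 2•Q = 0 → Q = 0` (HOME/RESIDUE.md §U2 row R2-9).

## Contents (all proved)

* `map_eq_one_of_inv_conj`: if `A ≤ Γ`, `ρ ∈ Γ` with `ρ a ρ⁻¹ = a⁻¹` on `A`, `ρ² ∈ A` and
  `Γ = A ∪ ρA`, then every homomorphism from `Γ` to a commutative group without elements of order `2`
  (e.g. `C₃`) is trivial — "`Γ^{ab}` is an elementary abelian `2`-group".
* `eq_comap_of_index_two`: if `A ⊴ Γ` is abelian of index `2`, `π : Γ ↠ P`, and `N` is the only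
  abelian normal subgroup of `P` of index dividing `2` (for `P ≅ S₃`: `N = A₃`), then `A = π⁻¹(N)`.

References: T4-PROOF.md v1.9b §3 L1 (b2b/bsd-rank1-residual/p2/idea-2/); D. A. Cox, *Primes of the
form x² + ny²*, 2nd ed., Lemma 9.3 (`Gal(L/ℚ) ≅ Gal(L/K) ⋊ ℤ/2` with conjugation acting by `σ ↦ σ⁻¹`
for ring class fields) [Cox2013].
-/

set_option autoImplicit false

namespace Summit.BirchSwinnertonDyer.Uniform.U2.RingClassGroup

/-- **A generalized dihedral group has no quotient without `2`-torsion** (so no `C₃` quotient):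
`A ≤ Γ`, `ρ` conjugating every element of `A` to its inverse, `ρ² ∈ A`, `Γ = A ∪ ρ·A`; then every
homomorphism `φ : Γ → C` into a commutative group in which `c² = 1 ⇒ c = 1` is trivial. (For
`a ∈ A`: `φ(a)⁻¹ = φ(ρaρ⁻¹) = φ(a)`; and `φ(ρ)² = φ(ρ²) ∈ φ(A) = 1`.) [cite: Cox2013, Lemma 9.3] -/
theorem map_eq_one_of_inv_conj {Γ C : Type*} [Group Γ] [CommGroup C] (A : Subgroup Γ) (ρ : Γ)
    (hconj : ∀ a ∈ A, ρ * a * ρ⁻¹ = a⁻¹) (hρ2 : ρ * ρ ∈ A)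
    (hcover : ∀ g : Γ, g ∈ A ∨ ρ⁻¹ * g ∈ A) (hC : ∀ c : C, c * c = 1 → c = 1) (φ : Γ →* C)
    (g : Γ) : φ g = 1 := by
  have hA : ∀ a ∈ A, φ a = 1 := by
    intro a ha
    apply hC
    have h1 : φ (ρ * a * ρ⁻¹) = (φ a)⁻¹ := by rw [hconj a ha, map_inv]
    have h2 : φ (ρ * a * ρ⁻¹) = φ a := by
      rw [map_mul, map_mul, map_inv, mul_comm (φ ρ) (φ a), mul_assoc, mul_inv_cancel, mul_one]
    have h3 : φ a = (φ a)⁻¹ := h2.symm.trans h1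
    calc φ a * φ a = φ a * (φ a)⁻¹ := by rw [← h3]
      _ = 1 := mul_inv_cancel _
  have hρ : φ ρ = 1 := by
    apply hC
    rw [← map_mul]
    exact hA _ hρ2
  rcases hcover g with hg | hg
  · exact hA g hg
  · have : g = ρ * (ρ⁻¹ * g) := by group
    rw [this, map_mul, hρ, one_mul, hA _ hg]

/-- The `C₃` case of L1 as a contradiction: under the same hypotheses no homomorphism from `Γ` ONTO a
nontrivial commutative group without `2`-torsion exists. [cite: Cox2013, Lemma 9.3] -/
theorem not_surjective_of_inv_conj {Γ C : Type*} [Group Γ] [CommGroup C] [Nontrivial C]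
    (A : Subgroup Γ) (ρ : Γ) (hconj : ∀ a ∈ A, ρ * a * ρ⁻¹ = a⁻¹) (hρ2 : ρ * ρ ∈ A)
    (hcover : ∀ g : Γ, g ∈ A ∨ ρ⁻¹ * g ∈ A) (hC : ∀ c : C, c * c = 1 → c = 1) (φ : Γ →* C) :
    ¬ Function.Surjective φ := by
  intro hφ
  obtain ⟨c, hc⟩ := exists_ne (1 : C)
  obtain ⟨g, rfl⟩ := hφ c
  exact hc (map_eq_one_of_inv_conj A ρ hconj hρ2 hcover hC φ g)

/-- In a group of ODD order, `c² = 1 ⇒ c = 1` (the hypothesis `hC` above for `C = C₃`,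
`Gal(F/ℚ) ≅ ℤ/3`). [folklore] -/
theorem eq_one_of_mul_self_eq_one_of_odd_card {C : Type*} [Group C] [Finite C]
    (hodd : Odd (Nat.card C)) (c : C) (hc : c * c = 1) : c = 1 := by
  have h2 : orderOf c ∣ 2 := by
    rw [orderOf_dvd_iff_pow_eq_one, pow_two, hc]
  have hcard : orderOf c ∣ Nat.card C := orderOf_dvd_natCard c
  rcases (Nat.dvd_prime Nat.prime_two).mp h2 with h | h
  · exact orderOf_eq_one_iff.mp h
  · exfalso
    rw [h] at hcard
    exact Nat.not_even_iff_odd.mpr hodd (even_iff_two_dvd.mpr hcard)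

/-- **The `S₃` case of L1**: `A ⊴ Γ` abelian of index `2`, `π : Γ ↠ P`, and `N ≤ P` the ONLY
abelian normal subgroup of index dividing `2` (for `P ≅ S₃`: `N = A₃` — the abelian normal subgroups
of `S₃` are `1` and `A₃`), with `[P : N] = 2`. Then `A = π⁻¹(N)` (the image `π(A)` is abelian,
normal, of index dividing `2`, hence `= N`; both `A` and `π⁻¹(N)` have index `2`). In L1 this reads
`Gal(H_c/K) = π⁻¹(A₃)`, i.e. `K = F^{A₃} = ℚ(√Δ_E)`. [cite: Cox2013, Lemma 9.3] -/
theorem eq_comap_of_index_two {Γ P : Type*} [Group Γ] [Group P] (A : Subgroup Γ) [hAn : A.Normal]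
    (hAcomm : ∀ a ∈ A, ∀ b ∈ A, a * b = b * a) (hAidx : A.index = 2) (π : Γ →* P)
    (hπ : Function.Surjective π) (N : Subgroup P) (hNidx : N.index = 2)
    (hN : ∀ M : Subgroup P, M.Normal → (∀ x ∈ M, ∀ y ∈ M, x * y = y * x) → M.index ∣ 2 → M = N) :
    A = N.comap π := by
  -- the image of `A` is abelian, normal, of index dividing `2`
  have hMn : (A.map π).Normal := hAn.map π hπ
  have hMcomm : ∀ x ∈ A.map π, ∀ y ∈ A.map π, x * y = y * x := by
    rintro _ ⟨a, ha, rfl⟩ _ ⟨b, hb, rfl⟩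
    rw [← map_mul, ← map_mul, hAcomm a ha b hb]
  have hMidx : (A.map π).index ∣ 2 := by
    rw [← hAidx]
    exact Subgroup.index_map_dvd A hπ
  have hM : A.map π = N := hN _ hMn hMcomm hMidx
  -- `A ≤ π⁻¹(N)` and both have index `2`
  have hle : A ≤ N.comap π := by
    rw [← hM]
    exact Subgroup.le_comap_map π A
  have hidx : (N.comap π).index = 2 := by
    rw [Subgroup.index_comap_of_surjective N hπ, hNidx]
  have hrel : A.relIndex (N.comap π) * (N.comap π).index = A.index :=
    Subgroup.relIndex_mul_index hle
  rw [hidx, hAidx] at hrel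
  have hrel1 : A.relIndex (N.comap π) = 1 := by omega
  exact le_antisymm hle (Subgroup.relIndex_eq_one.mp hrel1)

end Summit.BirchSwinnertonDyer.Uniform.U2.RingClassGroup
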